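import Summits.BirchSwinnertonDyer.Rank1Residual.Partition.CornersFiveLeCertificates
import Summits.BirchSwinnertonDyer.Rank1Residual.X2.ClassClosureOfDerivedTrivialZero
import HarnessLib

/-!
# `p ≥ 5`, 'good ORDINARY, or MULTIPLICATIVE', analytic rank `≤ 1` — the TWELFTH joint closing form
# MODULO THE X2a CLOSURE TERM: the thirteen Greenberg–Vatsal / Tate / character-`L`-function binders
# of the X2 branch replaced by the TWO closure terms they feed (`X2.TargetA` and the GV
# multiplicative clause), so that the Partition statement no longer depends on WHICH registered-fact
# derivation of the X2a closure is of record (cell `b2b-bsdres`, RESIDUAL-MAP.md §A / §C joint corner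
# predicate; rmap-1 gen 10, after eisenstein-p2 gens 24–27 re-threaded that derivation four times:
# `…_of_derivedFacts` → `…_of_derivedF0` → `…_of_datum` → `…_of_derivedTrivialZero`)

HONEST FRAMING (run/shared/lean/b2b/bsd-rank1-residual/, verbatim in every file): the goal of the
cell is to DELETE the COMBINATION-SHAPED residual classes of the Birch–Swinnerton-Dyer formula for
ALL analytic-rank `≤ 1` elliptic curves over `ℚ` — "full BSD formula for every rank `≤ 1` curve in
class `C`" assembled STRICTLY from published theorems — so that the rank-`≤ 1` remainder becomes
exactly the CONSTRUCTION-SHAPED classes, which are TYPED (missing-input `Prop`s), NOT attempted.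
This is not "finishing BSD". Theorems only; NO definition, NO named fact introduced here; every
published theorem enters as one of the tree's existing named Literature facts BY NAME; every
per-pair input is an explicit hypothesis asked ONLY on the cells that use it; nothing about any
particular curve is asserted; no label changes (X11a stays NEEDS X_C1, X11b stays NEEDS X_C2 /
CONSTRUCTION-SHAPED, X1 / X2 / X9 marks unchanged; X2a COVERED (PUB) — BOOKED is referee A's
R199.2 / R201.2 on the term p261163, untouched here); nothing is booked by this file; census and
instrument rows are EVIDENCE. The class-level statements behind the per-pair binders (Greenberg's
`μ`-conjecture on X9, Schneider's conjecture) are OPEN, NAMED, typed, NEVER asserted here.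

## What this file records

`Partition/CornersFiveLeCertificates.lean` (p276143, TWELFTH form) hard-wires the X2 branch to
`CornersMultTargetA.bsdp_mult_of_schneider_sharp_of_derivedFacts`, i.e. to ONE registered-fact
derivation of the X2a closure (binders `hT hT' hΛ hB hF hLiftF hP hEx h311 hLC hLD` + shared ones).
Since then eisenstein-p2 has DERIVED three of those binders on the tree (A223 `hEx` a theorem, gen 23;
A133 `hΛ` from the §2 datum records, gen 26; A137 `hF` from A137′ + A40, gen 27) and the "term of
record" moved accordingly. `CornersMultTargetA.bsdp_mult_of_schneider_sharp_targetA` (gen 9) already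
takes the X2 inputs as the TWO closure terms `hTA : X2.TargetA` and
`hGV : lambdaMu_multiplicative_of_gvPar`; this file lifts that parametrisation to the joint form:

* `bsdp_goodOrd_or_mult_of_five_le_rankLeOne_certificates_targetA` — **non-CM, `r ≤ 1`, `p ≥ 5`,
  good ordinary or multiplicative: `BSD(E,p)` unless
  `(X1 ∧ ¬gvpar) ∨ (X11a ∧ ¬surj) ∨ (X2 ∧ ¬(r = 0 ∧ gvpar) ∧ ¬(r = 1 ∧ ¬split ∧ gvpar)) ∨
  (X11b ∧ ¬Ram ∧ (¬surj ∨ (split ∧ no second multiplicative prime)))`**, granted TWENTY-NINE named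
  facts (the TWELFTH form's forty minus the eleven X2-derivation binders), the two X2 closure terms
  `hTA` / `hGV`, and the SAME per-pair hypotheses as the TWELFTH form (`hcert1`, `hμ9`, `hcert9`,
  `hSch9`, `hSchN`, `hSchS`, `hμ11`); proof = the TWELFTH form's case split verbatim with the X2
  branch sent to `bsdp_mult_of_schneider_sharp_targetA`;
* `bsdp_or_corner_goodOrd_or_mult_of_five_le_certificates_targetA` — the partition form;
* `bsdp_goodOrd_or_mult_of_five_le_rankLeOne_certificates_of_derivedTrivialZero` — the instance at
  the X2a term of record after eisenstein-p2 gen 27 (`hTA :=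
  X2.ClassClosureOfDerivedTrivialZero.targetA_of_derivedTrivialZero_heightFree`, seventeen facts;
  `hGV := X2.ClassClosureOfDerivedF0.lambdaMu_multiplicative_of_gvPar_of_derivedF0` fed with the
  derived A133 and A137 terms): THIRTY-NINE named facts (= forty − A223 − A133 − A137 + T-GV23L
  + A137′), same corner, same per-pair binders. Any later re-threading of the X2a term instantiates
  the `_targetA` theorem in one line; no further Partition leaf is needed for it.

No mark moves; nothing is booked; which X2a derivation is "of record" is the registry's / the
referee's call.

References: RESIDUAL-MAP.md §A / §C corner predicates (TWELFTH form, rmap-1 gen 9) and §I N1′ / N3 /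
N7 / N8 / N9; `Partition/CornersFiveLeCertificates.lean` (p276143); `Partition/CornersMultTargetA.lean`
(p267398); `X2/ClassClosureOfDerivedTrivialZero.lean` (p299093); [GreenbergVatsal2000] Thm. (1.3),
§2 Prop. (2.1), Cor. (2.3), Prop. (2.4), §3 Thm. (3.11); [Skinner2016PacificMC] Thm. A, Thm. C;
[SteinWuthrich2013] Thm. 6.1, §4.2; [Disegni2020] Thm. 1; [EmertonPollackWeston2006] Thm. 1, 3.1.1,
5.1.3; [Wan2015] Thm. 4; referee A ROUND 199 R199.2 / ROUND 201 R201.2.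
-/

noncomputable section

open scoped Classical MatrixGroups ModularForm NumberField

namespace Summit.BirchSwinnertonDyer.Rank1Residual

open CongruenceSubgroup WeierstrassCurve PowerSeries Literature.NumberTheory.EllipticCurves
  Literature.NumberTheory.EllipticCurves.Rank1Residual Literature.NumberTheory.EllipticCurves.ModularForms
  Literature.NumberTheory.EllipticCurves.Wuthrich2014
  Literature.NumberTheory.EllipticCurves.GreenbergVatsal2000
  Literature.NumberTheory.EllipticCurves.Rank1Residual.Typed
  Literature.NumberTheory.EllipticCurves.Skinner2016
  Literature.NumberTheory.EllipticCurves.SteinWuthrich2013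
  Literature.NumberTheory.EllipticCurves.Disegni2020
  Literature.NumberTheory.EllipticCurves.EmertonPollackWeston2006

section Curve

variable {W : WeierstrassCurve ℚ} [W.IsElliptic] [W.IsGloballyMinimal] {p : ℕ} [Fact p.Prime]

/-! ### The TWELFTH form modulo the two X2 closure terms -/

/-- **Non-CM, `p ≥ 5`, 'good ORDINARY, or MULTIPLICATIVE', analytic rank `≤ 1`, modulo the per-pair
certificate binders of record and the TWO X2 closure terms: TWENTY-NINE named facts.** `BSD(E,p)`
unless `(E,p)` lies in `X1 ∧ ¬gvpar` (type A), in X11a with NON-surjective `ρ̄_{E,p}`, in X2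
outside both its rank-`0` GV-parity sub-cell and its rank-`1` non-split GV-parity sub-cell, or in
X11b without a (ram) witness and with either non-surjective `ρ̄_{E,p}` or split reduction at `p`
and no second multiplicative prime — granted the X2a closure `hTA : X2.TargetA` and the
Greenberg–Vatsal multiplicative clause `hGV : lambdaMu_multiplicative_of_gvPar` (both THEOREMS of
the tree from registered facts, in whichever currency is of record), and, each only where used:
ONE bare Riemann-sum inequality for a newform on X1 ∧ gvpar (`hcert1`); Greenberg's `μ = 0`, the
unit-coefficient certificate and the good-ordinary Schneider certificate on X9 (`hμ9`, `hcert9`,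
`hSch9`); the two multiplicative Schneider binders (`hSchN`, `hSchS`); `μ^an(E,p) = 0` on the
surjective cells of X11a and of X11b-without-(ram) (`hμ11`). Case split of the TWELFTH form
(`bsdp_goodOrd_or_mult_of_five_le_rankLeOne_certificates`) verbatim, X2 branch through
`CornersMultTargetA.bsdp_mult_of_schneider_sharp_targetA`. [folklore] -/
theorem bsdp_goodOrd_or_mult_of_five_le_rankLeOne_certificates_targetA
    (hBCS : BurungaleCastellaSkinner2025.cor131_padicValRat_bsd_rank_le_one)
    (hBCSa : burungale_castella_skinner_charIdeal_eq_padicLFunction)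
    (hGZK : rank_eq_analyticRank_of_analyticRank_le_one)
    (hCGS : CastellaGrossiSkinner2025.thmD_padicValRat_bsd_rank_le_one)
    (hGVg : GreenbergVatsal2000.thm13_charIdeal_eq_of_gvPar) (hGr : greenberg_charValue_rankZero)
    (hmod : hasEntireLFunction_rat) (hmodP : nonempty_modularParametrizationData)
    (hS : Schneider1985_order_charGenerator) (hPR : perrinRiou_rankOne_leadingTerms)
    (hΩ : realPeriodRat_eq_unit_mul_plusPeriod)
    (hSk : Skinner2016.thmC_padicValRat_bsd_rank_zero) (hA : thmA_charIdeal_multiplicative)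
    (hD : thm1_padicBSD_rankOne_multiplicative)
    (hWu : thm16_charIdeal_dvd_multiplicative_of_reducible)
    (hJs : thm61_splitMultiplicative) (hJn : thm61_nonsplitMultiplicative)
    (hHs : exists_isSplitMultCanonical) (hHn : exists_isMultCanonical)
    (hGS : ∀ (W : WeierstrassCurve ℚ) [W.IsElliptic] [W.IsGloballyMinimal] (p : ℕ) [Fact p.Prime],
      greenberg_stevens (W := W) (p := p))
    (hHida : hida_exists_congruent_ordinary_newform_of_multiplicative)
    (hMTT : exists_isCycPAdicLFunctionWeightK)
    (h311e : thm311_cotorsion_weightK_member) (hT1a : thm1_muAlg_of_weightK_member)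
    (hT2 : Wan2015.thm4_rational_weightK_member_of_bdd)
    (hT1b : thm513_transfer_from_weightK_member_of_bdd)
    (h61 : DeligneSerre1974.thm61_exists_adicGaloisRep) (h326 : Hida2000_thm326_ordinary)
    (hKato : kato_charIdeal_dvd_multiplicative_of_surjective)
    (hGV : lambdaMu_multiplicative_of_gvPar) (hTA : X2.TargetA)
    (hcm : ¬ W.HasCM) (hr : W.analyticRank ≤ 1) (h5 : 5 ≤ p) (hdom : GoodOrd W p ∨ Mult W p)
    (hcert1 : ClassX1 W p → GVPar W p →
      ∃ (N : ℕ) (_ : NeZero N) (f : CuspForm (Gamma0 N) 2), IsNewformOf W f ∧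
        ∃ n : ℕ, (p : ℝ) ^ (-n : ℤ) < ‖padicLRiemannSum f (unitRoot W p : ℚ_[p]) 1 n‖)
    (hμ9 : ClassX9 W p → ∀ (κ : ZpExtension ℚ p) (γ : Field.absoluteGaloisGroup ℚ),
        κ.IsCyclotomic → κ.IsTopGenerator γ → IsCyclotomicVariable p γ →
      ∀ (D : W.SelmerDualData κ γ), D.mu = 0)
    (hcert9 : ClassX9 W p → ∀ [NeZero (W.conductorNorm ℤ)]
        (f : CuspForm (CongruenceSubgroup.Gamma0 (W.conductorNorm ℤ)) 2),
        IsNewformOf W f → ∀ (ϖ : ℚ), (ϖ : ℝ) * W.realPeriodRat = plusPeriod f →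
      ∃ n : ℕ, ‖PowerSeries.coeff n
        (PowerSeries.C (ϖ : ℚ_[p]) * padicLFunction f (unitRoot W p : ℚ_[p]))‖ = 1)
    (hSch9 : ClassX9 W p → ∀ Dh : PAdicHeightData W p, Dh.IsCanonical → SchneiderConjecture Dh)
    (hSchN : ∀ (q : ℚ_[p]) (Dh : PAdicHeightData W p), q ≠ 0 → ‖q‖ < 1 → tateJ q = (W.j : ℚ_[p]) →
      IsMultCanonical Dh q → SchneiderConjecture Dh)
    (hSchS : ∀ (Dq : TateParameterData W p) (Dh : PAdicHeightData W p),
      IsSplitMultCanonical Dh Dq → SchneiderConjecture Dh)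
    (hμ11 : ClassX11a W p ∨ (ClassX11b W p ∧ ¬ Ram W p) → Surj W p → X11a.MuAnZeroAt W p)
    (hA1 : ¬ (ClassX1 W p ∧ ¬ GVPar W p)) (hX11a : ¬ (ClassX11a W p ∧ ¬ Surj W p))
    (hX2 : ¬ (ClassX2 W p ∧ ¬ (W.analyticRank = 0 ∧ GVPar W p) ∧
      ¬ (W.analyticRank = 1 ∧ ¬ W.HasSplitMultiplicativeReductionAtPrime p ∧ GVPar W p)))
    (hX11b : ¬ (ClassX11b W p ∧ ¬ Ram W p ∧ (¬ Surj W p ∨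
      (W.HasSplitMultiplicativeReductionAtPrime p ∧
        ¬ ∃ (m : ℕ) (_ : Fact m.Prime), m ≠ p ∧ W.HasMultiplicativeReductionAtPrime m)))) :
    BSDp W p := by
  rcases hdom with hgo | hm
  · by_cases hX9 : ClassX9 W p
    · haveI : NeZero (W.conductorNorm ℤ) := ⟨(W.conductorNorm_pos_holds).ne'⟩
      exact bsdp_of_classX9_of_greenbergMu_of_schneider hBCSa hGr hΩ hS hPR hmodP hmod hGZK hr hX9
        (hμ9 hX9) (fun f hf ϖ hϖ => hcert9 hX9 f hf ϖ hϖ) (hSch9 hX9)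
    · exact bsdp_goodOrd_of_five_le_of_riemannSumLt_sharp hBCS hGZK hCGS hGVg hGr hmod hmodP hS hPR
        hcm hr hgo h5 hcert1 hA1 hX9
  · by_cases hXa : ClassX11a W p
    · have hsurj : Surj W p := by
        by_contra hns
        exact hX11a ⟨hXa, hns⟩
      exact bsdp_of_classX11a_of_surj_of_muAnZeroAt hHida hMTT h311e hT1a hT2 hT1b h61 h326 hKato
        hJs hJn hGZK hmod hmodP hGS hXa h5 hsurj (hμ11 (Or.inl hXa) hsurj)
    · by_cases hXb : ClassX11b W p ∧ ¬ Ram W p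
      · have hsurj : Surj W p := by
          by_contra hns
          exact hX11b ⟨hXb.1, hXb.2, Or.inl hns⟩
        have hsec : W.HasSplitMultiplicativeReductionAtPrime p →
            ∃ (m : ℕ) (_ : Fact m.Prime), m ≠ p ∧ W.HasMultiplicativeReductionAtPrime m := by
          intro hsplit
          by_contra hno
          exact hX11b ⟨hXb.1, hXb.2, Or.inr ⟨hsplit, hno⟩⟩
        exact bsdp_of_classX11b_of_surj_of_muAnZeroAt_of_schneider hHida hMTT h311e hT1a hT2 hT1b
          h61 h326 hKato hJn hJs hHn hHs hD hGZK hmodP hXb.1 h5 hsurj (hμ11 (Or.inr hXb) hsurj)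
          hsec hSchN hSchS
      · refine bsdp_mult_of_schneider_sharp_targetA hSk hmod hGZK hA hJn hJs hHn hHs hD hmodP hGV hWu
          hTA (by omega) hm hr hSchN hSchS hXa hX2 ?_
        rintro ⟨hX, hnot⟩
        by_cases hram : Ram W p
        · exact hnot ⟨hram, fun _ => h5⟩
        · exact hXb ⟨hX, hram⟩

/-- **Partition form, `p ≥ 5`, 'good ORDINARY, or MULTIPLICATIVE', rank `≤ 1`, modulo the per-pair
certificate binders and the two X2 closure terms:
`BSD(E,p) ∨ (X1 ∧ ¬gvpar) ∨ (X11a ∧ ¬surj) ∨ (X2 ∧ ¬(r = 0 ∧ gvpar) ∧ ¬(r = 1 ∧ ¬split ∧ gvpar))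
∨ (X11b ∧ ¬Ram ∧ (¬surj ∨ (split ∧ no second multiplicative prime)))`** from the same twenty-nine
named facts, `hGV` / `hTA`, and per-pair hypotheses. [folklore] -/
theorem bsdp_or_corner_goodOrd_or_mult_of_five_le_certificates_targetA
    (hBCS : BurungaleCastellaSkinner2025.cor131_padicValRat_bsd_rank_le_one)
    (hBCSa : burungale_castella_skinner_charIdeal_eq_padicLFunction)
    (hGZK : rank_eq_analyticRank_of_analyticRank_le_one)
    (hCGS : CastellaGrossiSkinner2025.thmD_padicValRat_bsd_rank_le_one)
    (hGVg : GreenbergVatsal2000.thm13_charIdeal_eq_of_gvPar) (hGr : greenberg_charValue_rankZero)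
    (hmod : hasEntireLFunction_rat) (hmodP : nonempty_modularParametrizationData)
    (hS : Schneider1985_order_charGenerator) (hPR : perrinRiou_rankOne_leadingTerms)
    (hΩ : realPeriodRat_eq_unit_mul_plusPeriod)
    (hSk : Skinner2016.thmC_padicValRat_bsd_rank_zero) (hA : thmA_charIdeal_multiplicative)
    (hD : thm1_padicBSD_rankOne_multiplicative)
    (hWu : thm16_charIdeal_dvd_multiplicative_of_reducible)
    (hJs : thm61_splitMultiplicative) (hJn : thm61_nonsplitMultiplicative)
    (hHs : exists_isSplitMultCanonical) (hHn : exists_isMultCanonical)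
    (hGS : ∀ (W : WeierstrassCurve ℚ) [W.IsElliptic] [W.IsGloballyMinimal] (p : ℕ) [Fact p.Prime],
      greenberg_stevens (W := W) (p := p))
    (hHida : hida_exists_congruent_ordinary_newform_of_multiplicative)
    (hMTT : exists_isCycPAdicLFunctionWeightK)
    (h311e : thm311_cotorsion_weightK_member) (hT1a : thm1_muAlg_of_weightK_member)
    (hT2 : Wan2015.thm4_rational_weightK_member_of_bdd)
    (hT1b : thm513_transfer_from_weightK_member_of_bdd)
    (h61 : DeligneSerre1974.thm61_exists_adicGaloisRep) (h326 : Hida2000_thm326_ordinary)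
    (hKato : kato_charIdeal_dvd_multiplicative_of_surjective)
    (hGV : lambdaMu_multiplicative_of_gvPar) (hTA : X2.TargetA)
    (hcm : ¬ W.HasCM) (hr : W.analyticRank ≤ 1) (h5 : 5 ≤ p) (hdom : GoodOrd W p ∨ Mult W p)
    (hcert1 : ClassX1 W p → GVPar W p →
      ∃ (N : ℕ) (_ : NeZero N) (f : CuspForm (Gamma0 N) 2), IsNewformOf W f ∧
        ∃ n : ℕ, (p : ℝ) ^ (-n : ℤ) < ‖padicLRiemannSum f (unitRoot W p : ℚ_[p]) 1 n‖)
    (hμ9 : ClassX9 W p → ∀ (κ : ZpExtension ℚ p) (γ : Field.absoluteGaloisGroup ℚ),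
        κ.IsCyclotomic → κ.IsTopGenerator γ → IsCyclotomicVariable p γ →
      ∀ (D : W.SelmerDualData κ γ), D.mu = 0)
    (hcert9 : ClassX9 W p → ∀ [NeZero (W.conductorNorm ℤ)]
        (f : CuspForm (CongruenceSubgroup.Gamma0 (W.conductorNorm ℤ)) 2),
        IsNewformOf W f → ∀ (ϖ : ℚ), (ϖ : ℝ) * W.realPeriodRat = plusPeriod f →
      ∃ n : ℕ, ‖PowerSeries.coeff n
        (PowerSeries.C (ϖ : ℚ_[p]) * padicLFunction f (unitRoot W p : ℚ_[p]))‖ = 1)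
    (hSch9 : ClassX9 W p → ∀ Dh : PAdicHeightData W p, Dh.IsCanonical → SchneiderConjecture Dh)
    (hSchN : ∀ (q : ℚ_[p]) (Dh : PAdicHeightData W p), q ≠ 0 → ‖q‖ < 1 → tateJ q = (W.j : ℚ_[p]) →
      IsMultCanonical Dh q → SchneiderConjecture Dh)
    (hSchS : ∀ (Dq : TateParameterData W p) (Dh : PAdicHeightData W p),
      IsSplitMultCanonical Dh Dq → SchneiderConjecture Dh)
    (hμ11 : ClassX11a W p ∨ (ClassX11b W p ∧ ¬ Ram W p) → Surj W p → X11a.MuAnZeroAt W p) :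
    BSDp W p ∨ (ClassX1 W p ∧ ¬ GVPar W p) ∨ (ClassX11a W p ∧ ¬ Surj W p) ∨
      (ClassX2 W p ∧ ¬ (W.analyticRank = 0 ∧ GVPar W p) ∧
        ¬ (W.analyticRank = 1 ∧ ¬ W.HasSplitMultiplicativeReductionAtPrime p ∧ GVPar W p)) ∨
      (ClassX11b W p ∧ ¬ Ram W p ∧ (¬ Surj W p ∨
        (W.HasSplitMultiplicativeReductionAtPrime p ∧
          ¬ ∃ (m : ℕ) (_ : Fact m.Prime), m ≠ p ∧ W.HasMultiplicativeReductionAtPrime m))) := by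
  by_cases hA1 : ClassX1 W p ∧ ¬ GVPar W p
  · exact Or.inr (Or.inl hA1)
  by_cases hX11a : ClassX11a W p ∧ ¬ Surj W p
  · exact Or.inr (Or.inr (Or.inl hX11a))
  by_cases hX2 : ClassX2 W p ∧ ¬ (W.analyticRank = 0 ∧ GVPar W p) ∧
      ¬ (W.analyticRank = 1 ∧ ¬ W.HasSplitMultiplicativeReductionAtPrime p ∧ GVPar W p)
  · exact Or.inr (Or.inr (Or.inr (Or.inl hX2)))
  by_cases hX11b : ClassX11b W p ∧ ¬ Ram W p ∧ (¬ Surj W p ∨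
      (W.HasSplitMultiplicativeReductionAtPrime p ∧
        ¬ ∃ (m : ℕ) (_ : Fact m.Prime), m ≠ p ∧ W.HasMultiplicativeReductionAtPrime m))
  · exact Or.inr (Or.inr (Or.inr (Or.inr hX11b)))
  exact Or.inl (bsdp_goodOrd_or_mult_of_five_le_rankLeOne_certificates_targetA hBCS hBCSa hGZK hCGS
    hGVg hGr hmod hmodP hS hPR hΩ hSk hA hD hWu hJs hJn hHs hHn hGS hHida hMTT h311e hT1a hT2 hT1b h61
    h326 hKato hGV hTA hcm hr h5 hdom hcert1 hμ9 hcert9 hSch9 hSchN hSchS hμ11 hA1 hX11a hX2 hX11b)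

/-! ### The instance at the X2a term of record after eisenstein-p2 gen 27 — thirty-nine named facts -/

/-- **Non-CM, `p ≥ 5`, 'good ORDINARY, or MULTIPLICATIVE', analytic rank `≤ 1`, modulo the per-pair
certificate binders of record — THIRTY-NINE named facts** (= the TWELFTH form's forty − A223 − A133
− A137 + T-GV23L + A137′): `bsdp_goodOrd_or_mult_of_five_le_rankLeOne_certificates_targetA` with
`hTA := X2.ClassClosureOfDerivedTrivialZero.targetA_of_derivedTrivialZero_heightFree` (seventeen
registered facts: T-GV23L, A137′, A40, A41, A135, A195, A180, A226, A224, A225, A33, A37 ×2, A18,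
A19 + parametrisation, Greenberg–Stevens) and `hGV :=
X2.ClassClosureOfDerivedF0.lambdaMu_multiplicative_of_gvPar_of_derivedF0` fed with the DERIVED
A133 (`lambda_nonPrimitive_eq_add_sum_delta_multiplicative_of_datum h23 hT hT' hInf`) and the DERIVED
A137 (`datumStrictSelmer_lt_datumSelmer_of_split_of_relIndex hT hInf`). Same corner, same per-pair
binders as the TWELFTH form.
[cite: GreenbergVatsal2000, Thm. (1.3); §1 pp. 14–15; §2 Prop. (2.1), Cor. (2.3), Prop. (2.4); §3 Thm. (3.11), (28)]
[cite: Skinner2016PacificMC, Thm. A, Thm. C] [cite: Wuthrich2014, Thm. 16 (p. 397)]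
[cite: SteinWuthrich2013, Thm. 6.1 (p. 20), §4.2] [cite: Disegni2020, Thm. 1]
[cite: EmertonPollackWeston2006, Thm. 1, Thm. 3.1.1, Thm. 5.1.3] [cite: Wan2015, Thm. 4] -/
theorem bsdp_goodOrd_or_mult_of_five_le_rankLeOne_certificates_of_derivedTrivialZero
    (hBCS : BurungaleCastellaSkinner2025.cor131_padicValRat_bsd_rank_le_one)
    (hBCSa : burungale_castella_skinner_charIdeal_eq_padicLFunction)
    (hGZK : rank_eq_analyticRank_of_analyticRank_le_one)
    (hCGS : CastellaGrossiSkinner2025.thmD_padicValRat_bsd_rank_le_one)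
    (hGVg : GreenbergVatsal2000.thm13_charIdeal_eq_of_gvPar) (hGr : greenberg_charValue_rankZero)
    (hmod : hasEntireLFunction_rat) (hmodP : nonempty_modularParametrizationData)
    (hS : Schneider1985_order_charGenerator) (hPR : perrinRiou_rankOne_leadingTerms)
    (hΩ : realPeriodRat_eq_unit_mul_plusPeriod)
    (hSk : Skinner2016.thmC_padicValRat_bsd_rank_zero) (hA : thmA_charIdeal_multiplicative)
    (hD : thm1_padicBSD_rankOne_multiplicative)
    (h23 : datumSelmer_nonPrimitive_invariants)
    (hInf : datumStrictSelmer_relIndex_eq_zero_of_split)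
    (hT : Silverman1994_thmV53_tateUniformisation.{0})
    (hT' : Silverman1994_thmV53_corV54_tateUniformisation.{0})
    (hB : datumSelmer_divisible_of_finite_torsionBy)
    (hLiftF : residualEpsilon_surjOn_of_lineRamifiedEven)
    (hP : cor38_realPeriodRat_eq_unit_mul_of_isIsogenous_of_gvPar)
    (h311 : thm311_hasUnitContent_iff_and_order_eq_of_lineRamifiedEven)
    (hLC : characterLFunctionC_hasUnitContent_and_order_eq_card)
    (hLD : characterLFunctionD_hasUnitContent_and_order_eq_card)
    (hWu : thm16_charIdeal_dvd_multiplicative_of_reducible)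
    (hJs : thm61_splitMultiplicative) (hJn : thm61_nonsplitMultiplicative)
    (hHs : exists_isSplitMultCanonical) (hHn : exists_isMultCanonical)
    (hGS : ∀ (W : WeierstrassCurve ℚ) [W.IsElliptic] [W.IsGloballyMinimal] (p : ℕ) [Fact p.Prime],
      greenberg_stevens (W := W) (p := p))
    (hHida : hida_exists_congruent_ordinary_newform_of_multiplicative)
    (hMTT : exists_isCycPAdicLFunctionWeightK)
    (h311e : thm311_cotorsion_weightK_member) (hT1a : thm1_muAlg_of_weightK_member)
    (hT2 : Wan2015.thm4_rational_weightK_member_of_bdd)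
    (hT1b : thm513_transfer_from_weightK_member_of_bdd)
    (h61 : DeligneSerre1974.thm61_exists_adicGaloisRep) (h326 : Hida2000_thm326_ordinary)
    (hKato : kato_charIdeal_dvd_multiplicative_of_surjective)
    (hcm : ¬ W.HasCM) (hr : W.analyticRank ≤ 1) (h5 : 5 ≤ p) (hdom : GoodOrd W p ∨ Mult W p)
    (hcert1 : ClassX1 W p → GVPar W p →
      ∃ (N : ℕ) (_ : NeZero N) (f : CuspForm (Gamma0 N) 2), IsNewformOf W f ∧
        ∃ n : ℕ, (p : ℝ) ^ (-n : ℤ) < ‖padicLRiemannSum f (unitRoot W p : ℚ_[p]) 1 n‖)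
    (hμ9 : ClassX9 W p → ∀ (κ : ZpExtension ℚ p) (γ : Field.absoluteGaloisGroup ℚ),
        κ.IsCyclotomic → κ.IsTopGenerator γ → IsCyclotomicVariable p γ →
      ∀ (D : W.SelmerDualData κ γ), D.mu = 0)
    (hcert9 : ClassX9 W p → ∀ [NeZero (W.conductorNorm ℤ)]
        (f : CuspForm (CongruenceSubgroup.Gamma0 (W.conductorNorm ℤ)) 2),
        IsNewformOf W f → ∀ (ϖ : ℚ), (ϖ : ℝ) * W.realPeriodRat = plusPeriod f →
      ∃ n : ℕ, ‖PowerSeries.coeff n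
        (PowerSeries.C (ϖ : ℚ_[p]) * padicLFunction f (unitRoot W p : ℚ_[p]))‖ = 1)
    (hSch9 : ClassX9 W p → ∀ Dh : PAdicHeightData W p, Dh.IsCanonical → SchneiderConjecture Dh)
    (hSchN : ∀ (q : ℚ_[p]) (Dh : PAdicHeightData W p), q ≠ 0 → ‖q‖ < 1 → tateJ q = (W.j : ℚ_[p]) →
      IsMultCanonical Dh q → SchneiderConjecture Dh)
    (hSchS : ∀ (Dq : TateParameterData W p) (Dh : PAdicHeightData W p),
      IsSplitMultCanonical Dh Dq → SchneiderConjecture Dh)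
    (hμ11 : ClassX11a W p ∨ (ClassX11b W p ∧ ¬ Ram W p) → Surj W p → X11a.MuAnZeroAt W p)
    (hA1 : ¬ (ClassX1 W p ∧ ¬ GVPar W p)) (hX11a : ¬ (ClassX11a W p ∧ ¬ Surj W p))
    (hX2 : ¬ (ClassX2 W p ∧ ¬ (W.analyticRank = 0 ∧ GVPar W p) ∧
      ¬ (W.analyticRank = 1 ∧ ¬ W.HasSplitMultiplicativeReductionAtPrime p ∧ GVPar W p)))
    (hX11b : ¬ (ClassX11b W p ∧ ¬ Ram W p ∧ (¬ Surj W p ∨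
      (W.HasSplitMultiplicativeReductionAtPrime p ∧
        ¬ ∃ (m : ℕ) (_ : Fact m.Prime), m ≠ p ∧ W.HasMultiplicativeReductionAtPrime m)))) :
    BSDp W p :=
  bsdp_goodOrd_or_mult_of_five_le_rankLeOne_certificates_targetA hBCS hBCSa hGZK hCGS hGVg hGr hmod
    hmodP hS hPR hΩ hSk hA hD hWu hJs hJn hHs hHn hGS hHida hMTT h311e hT1a hT2 hT1b h61 h326 hKato
    (X2.ClassClosureOfDerivedF0.lambdaMu_multiplicative_of_gvPar_of_derivedF0 hT hT'
      (X2.NonPrimitiveLambdaInvariantMultiplicativeDerived.lambda_nonPrimitive_eq_add_sum_delta_multiplicative_of_datum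
        h23 hT hT' hInf)
      hB (X2.TrivialZeroStrictInclusionDerived.datumStrictSelmer_lt_datumSelmer_of_split_of_relIndex hT hInf)
      hLiftF hP h311 hLC hLD hWu)
    (X2.ClassClosureOfDerivedTrivialZero.targetA_of_derivedTrivialZero_heightFree h23 hInf hT hT' hB
      hLiftF hP h311 hLC hLD hWu hJs hJn hGZK hmod hmodP hGS)
    hcm hr h5 hdom hcert1 hμ9 hcert9 hSch9 hSchN hSchS hμ11 hA1 hX11a hX2 hX11b

end Curve

end Summit.BirchSwinnertonDyer.Rank1Residual
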